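import Summits.ABC.IUTFork.Repair.RHReqsideWeightLawsSignRatioSharp
import HarnessLib

/-!
# D-0122 AXIS B, knob k1 × k3 — THE TYPED FORM, part 3e: `T(κ, c)` is MONOTONE in the pilot law `κ` and ANTITONE in the k3 radius multiplier `c`;
# every k1 × k3 cell of the table is bracketed by its two singles; `c`-free VANISHING under `κ = 1` (`m_q ≤ D`) and `κ = 3/2` (`⌈√l⋆⌉·m_q ≤ D`)

abc-iut cell, rung LADDER-ABC:A2.RESCUE.H; seat abc-iut-reqb-typ-1 (GEN 3; D-0122 axis B typer k1/k4; R69 (A1) hardening queue); owner abc-iut-rh-lead g3/g4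
(`plan/rescue/R-H/ROUND3/REQB-SPEC.md` v0.2 §1 k1/k3, §6(b) «every multiplier on D / R_in / R_out is rational and the floor is taken AFTER multiplication»,
pairs block k1κ × k3c); table of record `REQB-TABLE.tsv` v1 b8ac679ede5d795b, rows P-k1kappa1-k3c0 (PARTIAL 114/133 · 77/79; `Tmod/T_pooled` 0.0041 | 0.0013),
P-k1kappa1-k3c1/2 (131/133 · 79/79; 0.0004 | 0.0000), P-k1kappa3/2-k3c0 (37/133 · 38/79; 0.1071 | 0.1321), P-k1kappa3/2-k3c1/2 (68/133 · 62/79; 0.0432 | 0.0441).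
Parts 3a–3d = p516945 / p517864 / p519304 / p520175 (this seat); k3 in the print cell = abc-iut-reqb-typ-2's `ReqsideShellProfile` p507493
(`multiplierCell_le_print`, `radiusMultiplierCell_print_iff`) and `ReqsideLabelsInd.hullCellδ_mono_shell` p505937. Nothing re-typed.

THE k3 RADIUS MULTIPLIER IN THE k1-CELL. With `c = a/N` on `(R_in, R_out)` and the floor taken after multiplication, clearing denominators gives LITERALLY
`Cell f den (N·e) (N·m) (N·δ) (a·r_in) (a·r_out)` (margin `·N`; the print setting `a = N` is the unscaled cell by part 3a's `cell_scale`), so every k1 × k3 cell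
of the table is an `offDemand` at integer data and parts 3a–3d apply verbatim.
* §1 `offDemand_anti_shell` — **`T_f` IS ANTITONE IN THE ALLOWANCE under every law** (`δ ≤ δ′`, `r_in ≤ r_in′`, `r_out′ ≤ r_out` ⟹ `T′ ≤ T`; part 3a
  `cell_mono_shell`), `offDemand_radius_print` (`a = N` calibration), `offDemand_anti_radius` (**antitone in the radius multiplier** at places with `R_in ≥ 0 ≥ R_out`).
* §2 THE BRACKET: for a law `f ≤ print` (`den = 1 ≤ f`) and `0 ≤ a ≤ N`: **`T(S-k1-f) ≤ T(P-k1f-k3c) ≤ T(S-k3-c)`** place by place —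
  `single_le_pair` (needs `R_in ≥ 0 ≥ R_out`) and `pair_le_k3single` (no sign hypothesis); so every k1 × k3 pair cell's `T` lies between its two singles'.
* §3 `c`-FREE VANISHING: `pair_kappaOne_radius_eq_zero` (**`m ≤ δ` ⟹ `T(κ=1, c) = 0` for EVERY `c = a/N ≥ 0` and every label range** — needs only
  `δ ≥ 0`, `r_out ≤ r_in`), `pair_kappaThreeHalves_radius_eq_zero` (`⌈√L⌉·m ≤ δ`), `pair_print_radius_eq_zero` (`L·m ≤ δ`); worked place FREY `p = 7`,
  `l = 107` (`m = 210 ≤ δ = 1604`): `T(κ=1, c) = 0` at `c ∈ {0, 1/2, 1}`.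
CENSUS + CROSS-CHECK (this seat, in-seat python over gen 0's `P00_places_w.tsv` 5fd034e18b91fa58 = ENGINE A f639208a46862e5e P00 side w; COMPUTED ≠ PROVED):
`m_q ≤ D` at 955/1014 FREY133 · 501/509 HEX79 · 7/8 Q2+DH2 places (data with every place so: 95 · 71 · 3); `R_out > 0` (tame `R_out = 1`, outside §1–§2's sign
hypothesis) at 219 · 158 · 0 places, `R_in < 0` / `D < 0` at none. Reading the four pair rows through `Cell`/`offDemand` at `(N e, N m, N δ, a R_in, a R_out)`:
data with `T = 0` under (`κ=1`, `c=0`) 114 · 77 · 4, (`κ=1`, `c=½`) 131 · 79 · 4, (`κ=3/2`, `c=0`) 37 · 38 · 2, (`κ=3/2`, `c=½`) 68 · 62 · 4 = the rows'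
`n_ρ≥1` cells 114/133 · 77/79, 131 · 79, 37 · 38, 68 · 62 EXACTLY; pooled `T_mod/T_print` 0.0041 | 0.0013, 0.0004 | 0.0000, 0.1071 | 0.1321, 0.0432 | 0.0441 =
the table's cells EXACTLY; the bracket of §2 holds at the datum level for all 216 data × {κ=1, 3/2} × {c = 0, ½, 1} (0 violations) although 377 places have
`R_out = 1`.
HONEST FRAMING: integer arithmetic about OUR typed cell; `κ ≠ 2` and `c ≠ 1` are hypothetical PARAMETER settings (REQB-SPEC FRAMING; CONSISTENCY =
abc-iut-reqb-rf-1 / rf-2's columns: these four rows are worded INCONSISTENT there, located ≠ adjudicated); tier L0 only; census numerals computed, not proved;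
nothing here asserts that abc is proved or refuted, or that [IUTchIII] Cor. 3.12 / [IUTchIV] Thm. 1.10 holds or fails at any datum, or takes a side on any
author; typed ≠ proved; computed ≠ proved. [claim: Mochizuki2012, status: disputed] for every IUT locution.
[cite: Mochizuki2012, IUTchIII Thm. 3.11 (i)–(iii), Cor. 3.12 p. 173–174; IUTchIV Prop. 1.2 p. 10, Prop. 1.4 p. 13]
-/

noncomputable section

open Finset

namespace Summit.ABC.IUTFork.Repair.RH.ReqsideWeightLaws

/-! ## §1. `T` is antitone in the allowance; the radius multiplier -/

open Classical in
/-- **`T_f` IS ANTITONE IN THE ALLOWANCE under every law** (`den > 0`, `e > 0`, demands `≥ 0`): a looser shell `δ ≤ δ′`, `r_in ≤ r_in′`, `r_out′ ≤ r_out`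
licenses more (part 3a `cell_mono_shell`), so the unlicensed demand can only drop: `T_f(δ′, r_in′, r_out′) ≤ T_f(δ, r_in, r_out)`. The k3 SIGN for every
k1 law at once (print: abc-iut-reqb-typ-2's `sliceBoundary_le_of_imp`). [folklore] -/
theorem offDemand_anti_shell {f : ℕ → ℤ} {den e m δ δ' rin rin' rout rout' : ℤ} (hden : 0 < den) (he : 0 < e)
    (hf : ∀ j, 1 ≤ j → den ≤ f j) (hδ : δ ≤ δ') (hi : rin ≤ rin') (ho : rout' ≤ rout) (L : ℕ) :
    offDemand f den e m δ' rin' rout' L ≤ offDemand f den e m δ rin rout L := by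
  unfold offDemand
  refine Finset.sum_le_sum fun i _ => ?_
  have h1 := hf (i + 1) (Nat.succ_pos i)
  by_cases hc : Cell f den e m δ rin rout (i + 1)
  · rw [if_pos hc, if_pos (cell_mono_shell hden he hδ hi ho hc)]
  · rw [if_neg hc]
    split_ifs
    · linarith
    · exact le_rfl

open Classical in
/-- **PRINT CALIBRATION of the radius multiplier**: at `a = N` the cleared-denominator cell `(N·e, N·m, N·δ, N·r_in, N·r_out)` has the same `T` as the
unscaled place (part 3a `cell_scale`). [folklore] -/
theorem offDemand_radius_print (f : ℕ → ℤ) (den : ℤ) {N : ℤ} (hN : 0 < N) (e m δ rin rout : ℤ) (L : ℕ) :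
    offDemand f den (N * e) (N * m) (N * δ) (N * rin) (N * rout) L = offDemand f den e m δ rin rout L := by
  unfold offDemand
  refine Finset.sum_congr rfl fun i _ => ?_
  have hc := cell_scale f den (e := e) (m := m) (δ := δ) (rin := rin) (rout := rout) hN (i + 1)
  by_cases h : Cell f den e m δ rin rout (i + 1)
  · rw [if_pos h, if_pos (hc.2 h)]
  · rw [if_neg h, if_neg (fun h' => h (hc.1 h'))]

/-- **`T_f` IS ANTITONE IN THE RADIUS MULTIPLIER** `c = a/N` at a place with `R_in ≥ 0 ≥ R_out` (`den > 0`, `e > 0`, `N > 0`, demands `≥ 0`): `a ≤ b ⟹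
T_f(c = b/N) ≤ T_f(c = a/N)` — a larger indeterminacy allowance licenses more. (Places with `R_out > 0`, the tame `R_out = 1`, are outside the hypothesis.)
[folklore] -/
theorem offDemand_anti_radius {f : ℕ → ℤ} {den e m δ rin rout N a b : ℤ} (hden : 0 < den) (he : 0 < e) (hN : 0 < N)
    (hf : ∀ j, 1 ≤ j → den ≤ f j) (hrin : 0 ≤ rin) (hrout : rout ≤ 0) (hab : a ≤ b) (L : ℕ) :
    offDemand f den (N * e) (N * m) (N * δ) (b * rin) (b * rout) L ≤ offDemand f den (N * e) (N * m) (N * δ) (a * rin) (a * rout) L :=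
  offDemand_anti_shell hden (mul_pos hN he) hf le_rfl (mul_le_mul_of_nonneg_right hab hrin) (by nlinarith) L

/-! ## §2. The bracket: every k1 × k3 cell lies between its two singles -/

/-- **`T(S-k1-f) ≤ T(P-k1f-k3c)`** for `c = a/N ≤ 1` at a place with `R_in ≥ 0 ≥ R_out`: tightening the radii under a fixed law never lowers `T`
(`offDemand_anti_radius` with `a ≤ N`, then the `a = N` calibration). [folklore] -/
theorem single_le_pair {f : ℕ → ℤ} {den e m δ rin rout N a : ℤ} (hden : 0 < den) (he : 0 < e) (hN : 0 < N)
    (hf : ∀ j, 1 ≤ j → den ≤ f j) (hrin : 0 ≤ rin) (hrout : rout ≤ 0) (haN : a ≤ N) (L : ℕ) :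
    offDemand f den e m δ rin rout L ≤ offDemand f den (N * e) (N * m) (N * δ) (a * rin) (a * rout) L := by
  rw [← offDemand_radius_print f den hN e m δ rin rout L]
  exact offDemand_anti_radius hden he hN hf hrin hrout haN L

/-- **`T(P-k1f-k3c) ≤ T(S-k3-c)`** for a law `f` below print (`1 ≤ f(j) ≤ j²` on labels `≥ 1`; `e > 0`, `m ≥ 0`, `N > 0`): at the SAME multiplier the
lighter law has the smaller `T` (part 3a `offDemand_mono_law` at the cleared-denominator data; no sign hypothesis on the radii). [folklore] -/
theorem pair_le_k3single {f : ℕ → ℤ} {e m δ rin rout N : ℤ} (he : 0 < e) (hm : 0 ≤ m) (hN : 0 < N)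
    (hf : ∀ j, 1 ≤ j → 1 ≤ f j) (hfp : ∀ j, 1 ≤ j → f j ≤ (j : ℤ) ^ 2) (a : ℤ) (L : ℕ) :
    offDemand f 1 (N * e) (N * m) (N * δ) (a * rin) (a * rout) L ≤
      offDemand (fun j => (j : ℤ) ^ 2) 1 (N * e) (N * m) (N * δ) (a * rin) (a * rout) L :=
  offDemand_mono_law one_pos (mul_pos hN he) (by nlinarith) hf hfp L

/-- THE BRACKET for the κ-laws `κ ≤ 2` (`lawPow k`, `k ≤ 4`) at `0 ≤ … a ≤ N`, `R_in ≥ 0 ≥ R_out`, `e > 0`, `m ≥ 0`: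
`T(S-k1-κ) ≤ T(P-k1κ-k3c) ≤ T(S-k3-c)` — rows P-k1kappa1-k3c0, P-k1kappa1-k3c1/2 (`k = 2`) and P-k1kappa3/2-k3c0, P-k1kappa3/2-k3c1/2 (`k = 3`). [folklore] -/
theorem pair_bracket_lawPow {k : ℕ} (hk : k ≤ 4) {e m δ rin rout N a : ℤ} (he : 0 < e) (hm : 0 ≤ m) (hN : 0 < N) (hrin : 0 ≤ rin)
    (hrout : rout ≤ 0) (haN : a ≤ N) (L : ℕ) :
    offDemand (lawPow k) 1 e m δ rin rout L ≤ offDemand (lawPow k) 1 (N * e) (N * m) (N * δ) (a * rin) (a * rout) L ∧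
      offDemand (lawPow k) 1 (N * e) (N * m) (N * δ) (a * rin) (a * rout) L ≤
        offDemand (fun j => (j : ℤ) ^ 2) 1 (N * e) (N * m) (N * δ) (a * rin) (a * rout) L :=
  ⟨single_le_pair one_pos he hN (fun _ hj => one_le_lawPow k hj) hrin hrout haN L,
    pair_le_k3single he hm hN (fun _ hj => one_le_lawPow k hj) (fun j hj => by rw [← lawPow_four j]; exact lawPow_mono_exp hj hk) a L⟩

/-! ## §3. `c`-free vanishing -/

/-- **`κ = 1` × k3: `m ≤ δ` ⟹ `T(κ=1, c) = 0` for EVERY radius multiplier `c = a/N ≥ 0` and every label range** (`e > 0`, `N > 0`, `δ ≥ 0`,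
`r_out ≤ r_in`; no sign on the radii themselves): `N·m ≤ N·δ + a·(r_in − r_out)` feeds part 3a's `offDemand_id_eq_zero`. Census: `m_q ≤ D` at 955 · 501 · 7
bed places. [folklore] -/
theorem pair_kappaOne_radius_eq_zero {e m δ rin rout N a : ℤ} (he : 0 < e) (hN : 0 < N) (ha : 0 ≤ a) (hδ : 0 ≤ δ) (hG : rout ≤ rin)
    (h : m ≤ δ) (L : ℕ) : offDemand (fun j => (j : ℤ)) 1 (N * e) (N * m) (N * δ) (a * rin) (a * rout) L = 0 :=
  offDemand_id_eq_zero (mul_pos hN he) (by nlinarith) (by nlinarith) (by nlinarith) L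

/-- **`κ = 3/2` × k3: `⌈√L⌉·m ≤ δ` ⟹ `T(κ=3/2, c) = 0` on `{1..L}` for every `c = a/N ≥ 0`** (`m ≥ 0`, `r_out ≤ r_in`). [folklore] -/
theorem pair_kappaThreeHalves_radius_eq_zero {e m δ rin rout N a : ℤ} (he : 0 < e) (hN : 0 < N) (ha : 0 ≤ a) (hm : 0 ≤ m) (hG : rout ≤ rin)
    {L : ℕ} (h : (ceilSqrt L : ℤ) * m ≤ δ) : offDemand (lawPow 3) 1 (N * e) (N * m) (N * δ) (a * rin) (a * rout) L = 0 := by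
  refine offDemand_lawPow_three_eq_zero (mul_pos hN he) (by nlinarith) (by nlinarith) ?_
  have hc : (0 : ℤ) ≤ (ceilSqrt L : ℤ) := Nat.cast_nonneg _
  nlinarith [mul_le_mul_of_nonneg_left h hN.le, mul_nonneg ha (by linarith : (0 : ℤ) ≤ rin - rout)]

/-- **print × k3: `L·m ≤ δ` ⟹ `T_print(c) = 0` on `{1..L}` for every `c = a/N ≥ 0`** (`m ≥ 0`, `r_out ≤ r_in`) — the few bed places where print needs no
radius at all. [folklore] -/
theorem pair_print_radius_eq_zero {e m δ rin rout N a : ℤ} (he : 0 < e) (hN : 0 < N) (ha : 0 ≤ a) (hm : 0 ≤ m) (hG : rout ≤ rin)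
    {L : ℕ} (h : (L : ℤ) * m ≤ δ) : offDemand (fun j => (j : ℤ) ^ 2) 1 (N * e) (N * m) (N * δ) (a * rin) (a * rout) L = 0 := by
  refine offDemand_sq_eq_zero (mul_pos hN he) (by nlinarith) (by nlinarith) ?_
  have hL : (0 : ℤ) ≤ (L : ℤ) := Nat.cast_nonneg _
  nlinarith [mul_le_mul_of_nonneg_left h hN.le, mul_nonneg ha (by linarith : (0 : ℤ) ≤ rin - rout)]

/-- WORKED PLACE FREY `p = 7`, `l = 107` (`e 1605, m 210, δ 1604, r_in 268, r_out −4472, L = 53`): `m = 210 ≤ δ = 1604`, so the κ = 1 × k3 cells VANISH at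
`c = 0` (`a = 0, N = 1`), `c = 1/2` (`a = 1, N = 2`) and `c = 1`. [folklore] -/
theorem worked_pair_kappaOne :
    offDemand (fun j => (j : ℤ)) 1 (1 * 1605) (1 * 210) (1 * 1604) (0 * 268) (0 * (-4472)) 53 = 0 ∧
      offDemand (fun j => (j : ℤ)) 1 (2 * 1605) (2 * 210) (2 * 1604) (1 * 268) (1 * (-4472)) 53 = 0 ∧
        offDemand (fun j => (j : ℤ)) 1 (1 * 1605) (1 * 210) (1 * 1604) (1 * 268) (1 * (-4472)) 53 = 0 :=
  ⟨pair_kappaOne_radius_eq_zero (by norm_num) one_pos le_rfl (by norm_num) (by norm_num) (by norm_num) 53,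
    pair_kappaOne_radius_eq_zero (by norm_num) two_pos zero_le_one (by norm_num) (by norm_num) (by norm_num) 53,
    pair_kappaOne_radius_eq_zero (by norm_num) one_pos zero_le_one (by norm_num) (by norm_num) (by norm_num) 53⟩

end Summit.ABC.IUTFork.Repair.RH.ReqsideWeightLaws

end
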